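import Summits.CriticalPhenomena.SAWScalingLimit.Theorems.SAWReversalUpgradeFaithfulOfNoReturnOrder
import Summits.CriticalPhenomena.SAWScalingLimit.Theorems.SAWReversalUpgradeAttachmentExistsInverse
import HarnessLib

/-!
# Route `SAWReversalUpgrade`, support `FaithfulOfNoReturn` (stmt-CriticalPhenomena-18008):
# the access segment and the first cut time `uMid`

Helper file (4 of several) for the proof of
`Summit.CriticalPhenomena.SAWScalingLimit.Theses.SAWReversalUpgrade.FaithfulOfNoReturn`,
in the vocabulary of `SAWReversalUpgradeAttachReversalDefs` (`pAcc`, `sAcc`, `uMid`).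

The access segment is `t ↦ Φ (t · p)`, `p = pAcc a Φ e R = A_e (ψ (R i))`, `i = lastA a R`.
Two regimes: if `R i ≠ a` then `i = 0`, `p ∈ ℍₒ`, the segment is a simple arc from `a` into `D`,
`sAcc ∈ (0, 1]` is its first parameter meeting the pushed middle arc `midSet`; if `R i = a` then
`p = 0`, the segment degenerates to `{a}` and `sAcc = 0`. In both regimes we prove the facts the
model-curve argument consumes (`sAcc_facts`), and then analyse the cut time
`uMid = inf {u ∈ [i, j] | Z u = Φ (sAcc · p)}`: it is attained, the polyline is `r₀/2`-close to `a`
there, hence (no deep return) `ε₀`-close to `a` on `[0, uMid]`.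
-/

noncomputable section

open Set Filter Metric Complex Function
open scoped Topology
open UpperHalfPlane (upperHalfPlaneSet)
open Literature.Probability.RandomPlanarGeometry

namespace Summit.CriticalPhenomena.SAWScalingLimit.Theorems

namespace FaithfulAttach

open AttachReversal

variable {D : DobrushinDomain} {φ : ConformalEquiv upperHalfPlaneSet D.carrier} {e : ℝ} {R : ℝ → ℂ}

/-! ### Rays `t ↦ Φ (t · w)` through a point `w` of the open half-plane -/

section Ray

variable (hφ : D.IsChordalUniformizing φ) {w : ℂ} (hw : 0 < w.im)
include hφ hw

omit hw in
/-- The ray starts at `a`: `Φ (0 · w) = a`. -/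
theorem ray_zero : φ.boundaryExtension (((0:ℝ) : ℂ) * w) = D.pt 0 := by
  rw [ofReal_zero, zero_mul, bext_zero hφ]

omit hφ in
/-- For `t > 0` the ray lies in `D`. -/
theorem ray_mem_carrier {t : ℝ} (ht : 0 < t) : φ.boundaryExtension ((t : ℂ) * w) ∈ D.carrier :=
  bext_mem_carrier φ (ray_im_pos hw ht)

/-- For `t ≥ 0` the ray lies in `D ∪ {a}`. -/
theorem ray_eq_or_mem {t : ℝ} (ht : 0 ≤ t) :
    φ.boundaryExtension ((t : ℂ) * w) = D.pt 0 ∨ φ.boundaryExtension ((t : ℂ) * w) ∈ D.carrier := by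
  rcases ht.eq_or_lt with rfl | ht'
  · exact Or.inl (ray_zero hφ)
  · exact Or.inr (ray_mem_carrier hw ht')

/-- The ray never reaches `b`. -/
theorem ray_ne_pt_one {t : ℝ} (ht : 0 ≤ t) : φ.boundaryExtension ((t : ℂ) * w) ≠ D.pt 1 :=
  bext_ne_pt_one hφ (ray_im_nonneg hw.le ht)

omit hφ in
/-- The ray is continuous on `[0, ∞)`. -/
theorem continuousOn_ray : ContinuousOn (fun t : ℝ => φ.boundaryExtension ((t : ℂ) * w)) (Ici 0) :=
  (continuousOn_boundaryExtension_im_nonneg φ).comp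
    ((continuous_ofReal.mul continuous_const).continuousOn) fun _ ht => ray_im_nonneg hw.le ht

omit hφ in
/-- The ray is injective on `[0, ∞)`. -/
theorem injOn_ray : InjOn (fun t : ℝ => φ.boundaryExtension ((t : ℂ) * w)) (Ici 0) := by
  intro t ht t' ht' h
  have hw0 : w ≠ 0 := fun h0 => by rw [h0, zero_im] at hw; exact lt_irrefl _ hw
  have h1 := bext_injOn φ (ray_im_nonneg hw.le ht) (ray_im_nonneg hw.le ht') h
  exact_mod_cast mul_right_cancel₀ hw0 h1

omit hφ hw in
/-- Norm along the ray. -/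
theorem norm_ray (t : ℝ) (ht : 0 ≤ t) (w : ℂ) : ‖(t : ℂ) * w‖ = t * ‖w‖ := by
  rw [norm_mul, Complex.norm_real, Real.norm_eq_abs, abs_of_nonneg ht]

end Ray

/-! ### The access segment and `sAcc` -/

section Access

variable (hφ : D.IsChordalUniformizing φ) (he0 : 0 < e) (he1 : e ≤ 1 / 2)
  (hRc : Continuous R) (hRmem : ∀ u, R u ∈ closure D.carrier) (hR0 : R 0 ∈ D.carrier)
  (hij : lastA (D.pt 0) R ≤ firstB (D.pt 1) R)

/-- `pAcc` unfolded. -/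
theorem pAcc_eq (a : ℂ) (Φ : ℂ → ℂ) (e : ℝ) (R : ℝ → ℂ) :
    pAcc a Φ e R = squeeze e (hinv Φ (R (lastA a R))) := rfl

include hRc hR0 in
/-- In the regime `R i ≠ a` we have `i = 0`, so `R i = R 0 ∈ D`. -/
theorem apply_lastA_mem_carrier (hia : R (lastA (D.pt 0) R) ≠ D.pt 0) :
    R (lastA (D.pt 0) R) ∈ D.carrier := by
  rcases lastA_spec hRc (D.pt 0) with h | h
  · rwa [h]
  · exact absurd h hia

include hφ he0 he1 hRc hR0 in
/-- In the regime `R i ≠ a`, the access direction `p` lies in the open half-plane. -/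
theorem im_pAcc_pos (hia : R (lastA (D.pt 0) R) ≠ D.pt 0) :
    0 < (pAcc (D.pt 0) φ.boundaryExtension e R).im := by
  have hD := apply_lastA_mem_carrier hRc hR0 hia
  have hw := hinv_im_pos hφ hD
  refine sqz_im_pos he0 he1 (squeeze_spec e) hw.le fun h0 => ?_
  rw [h0, zero_im] at hw
  exact lt_irrefl _ hw

include hφ in
/-- In the regime `R i = a`, the access direction vanishes: `p = 0`. -/
theorem pAcc_eq_zero (hia : R (lastA (D.pt 0) R) = D.pt 0) : pAcc (D.pt 0) φ.boundaryExtension e R = 0 := by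
  rw [pAcc_eq, hia, hinv_pt_zero hφ, sqz_zero (squeeze_spec e)]

include hRc hR0 hij in
/-- In the regime `R i ≠ a`: `Φ p = Z i ∈ midSet`, i.e. the parameter `1` is admissible for `sAcc`. -/
theorem one_mem_sAcc_set (hia : R (lastA (D.pt 0) R) ≠ D.pt 0) :
    (1:ℝ) ∈ {s : ℝ | s ∈ Ioc (0:ℝ) 1 ∧ φ.boundaryExtension ((s : ℂ) * pAcc (D.pt 0) φ.boundaryExtension e R) ∈
      midSet (D.pt 0) (D.pt 1) φ.boundaryExtension e R} := by
  refine ⟨⟨zero_lt_one, le_rfl⟩, ⟨lastA (D.pt 0) R, ⟨le_rfl, hij⟩, ?_⟩⟩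
  have hib : R (lastA (D.pt 0) R) ≠ D.pt 1 := fun h =>
    MarkedDomain.pt_notMem_carrier D 1 (h ▸ apply_lastA_mem_carrier hRc hR0 hia)
  rw [attZ_apply, if_neg hib, ofReal_one, one_mul, pAcc_eq]

include hφ he0 he1 hRc hRmem hR0 hij in
/-- **The access facts.** With `p = pAcc`, `s = sAcc`, `M = midSet`, `α t = Φ (t · p)`:
`s ∈ [0, 1]`; `α s ∈ M`; `α 0 = a`; `α` is continuous on `[0, ∞)` and injective on `[0, s]`;
`α t ∉ M` for `t ∈ [0, s)`; `α t ∈ D ∪ {a}` and `‖t · p‖ ≤ ‖ψ (R 0)‖` for `t ∈ [0, 1]`. -/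
theorem sAcc_facts :
    sAcc (D.pt 0) (D.pt 1) φ.boundaryExtension e R ∈ Icc (0:ℝ) 1 ∧
    φ.boundaryExtension ((sAcc (D.pt 0) (D.pt 1) φ.boundaryExtension e R : ℂ) *
      pAcc (D.pt 0) φ.boundaryExtension e R) ∈ midSet (D.pt 0) (D.pt 1) φ.boundaryExtension e R ∧
    φ.boundaryExtension (((0:ℝ) : ℂ) * pAcc (D.pt 0) φ.boundaryExtension e R) = D.pt 0 ∧
    ContinuousOn (fun t : ℝ => φ.boundaryExtension ((t : ℂ) * pAcc (D.pt 0) φ.boundaryExtension e R))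
      (Ici 0) ∧
    InjOn (fun t : ℝ => φ.boundaryExtension ((t : ℂ) * pAcc (D.pt 0) φ.boundaryExtension e R))
      (Icc 0 (sAcc (D.pt 0) (D.pt 1) φ.boundaryExtension e R)) ∧
    (∀ t ∈ Ico (0:ℝ) (sAcc (D.pt 0) (D.pt 1) φ.boundaryExtension e R),
      φ.boundaryExtension ((t : ℂ) * pAcc (D.pt 0) φ.boundaryExtension e R) ∉
        midSet (D.pt 0) (D.pt 1) φ.boundaryExtension e R) ∧
    (∀ t : ℝ, 0 ≤ t →
      (φ.boundaryExtension ((t : ℂ) * pAcc (D.pt 0) φ.boundaryExtension e R) = D.pt 0 ∨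
        φ.boundaryExtension ((t : ℂ) * pAcc (D.pt 0) φ.boundaryExtension e R) ∈ D.carrier) ∧
      0 ≤ ((t : ℂ) * pAcc (D.pt 0) φ.boundaryExtension e R).im) ∧
    (∀ t ∈ Icc (0:ℝ) 1, ‖(t : ℂ) * pAcc (D.pt 0) φ.boundaryExtension e R‖ ≤
      ‖hinv φ.boundaryExtension (R 0)‖) := by
  set p := pAcc (D.pt 0) φ.boundaryExtension e R with hp
  set M := midSet (D.pt 0) (D.pt 1) φ.boundaryExtension e R with hM
  have hMc : IsClosed M := isClosed_midSet hφ he0 he1 hRc hRmem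
  by_cases hia : R (lastA (D.pt 0) R) = D.pt 0
  · -- degenerate regime: `p = 0`, the segment is `{a}`, `sAcc = 0`
    have hp0 : p = 0 := pAcc_eq_zero hφ hia
    have haM : D.pt 0 ∈ M := pt_zero_mem_midSet hφ he0 he1 hRmem hij hia
    have hconst : ∀ t : ℝ, φ.boundaryExtension ((t : ℂ) * p) = D.pt 0 := fun t => by
      rw [hp0, mul_zero, bext_zero hφ]
    have hs0 : sAcc (D.pt 0) (D.pt 1) φ.boundaryExtension e R = 0 := by
      rw [sAcc]
      have : {s : ℝ | s ∈ Ioc (0:ℝ) 1 ∧ φ.boundaryExtension ((s : ℂ) * p) ∈ M} = Ioc 0 1 := by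
        ext t
        simp only [mem_setOf_eq, hconst t, and_iff_left_iff_imp]
        exact fun _ => haM
      rw [← hp, ← hM, this]
      exact csInf_Ioc zero_lt_one
    rw [hs0]
    refine ⟨⟨le_rfl, zero_le_one⟩, by rw [hconst]; exact haM, hconst 0, ?_, ?_, ?_, ?_, ?_⟩
    · exact continuousOn_const.congr fun t _ => hconst t
    · intro t ht t' ht' _
      rw [mem_Icc] at ht ht'
      exact le_antisymm (ht.2.trans ht'.1) (ht'.2.trans ht.1)
    · intro t ht
      exact absurd ht.2 (not_lt.2 ht.1)
    · intro t _
      refine ⟨Or.inl (hconst t), ?_⟩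
      rw [hp0, mul_zero, zero_im]
    · intro t _
      rw [hp0, mul_zero, norm_zero]
      exact norm_nonneg _
  · -- generic regime: `i = 0`, `p ∈ ℍₒ`
    have hi0 : lastA (D.pt 0) R = 0 := by
      rcases lastA_spec hRc (D.pt 0) with h | h
      · exact h
      · exact absurd h hia
    have hw : 0 < (p : ℂ).im := im_pAcc_pos hφ he0 he1 hRc hR0 hia
    have haM : D.pt 0 ∉ M := fun h => hia (apply_lastA_eq_of_pt_zero_mem_midSet hφ he0 he1 hRc hRmem h)
    set S : Set ℝ := {s : ℝ | s ∈ Ioc (0:ℝ) 1 ∧ φ.boundaryExtension ((s : ℂ) * p) ∈ M} with hS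
    have hS_eq : S = Icc 0 1 ∩ (fun t : ℝ => φ.boundaryExtension ((t : ℂ) * p)) ⁻¹' M := by
      ext t
      simp only [hS, mem_setOf_eq, mem_inter_iff, mem_preimage, mem_Ioc, mem_Icc]
      constructor
      · rintro ⟨⟨h1, h2⟩, h3⟩
        exact ⟨⟨h1.le, h2⟩, h3⟩
      · rintro ⟨⟨h1, h2⟩, h3⟩
        refine ⟨⟨h1.lt_of_ne ?_, h2⟩, h3⟩
        rintro rfl
        rw [ray_zero hφ] at h3
        exact haM h3
    have hSc : IsClosed S := by
      rw [hS_eq]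
      exact ((continuousOn_ray hw).mono Icc_subset_Ici_self).preimage_isClosed_of_isClosed
        isClosed_Icc hMc
    have h1S : (1:ℝ) ∈ S := one_mem_sAcc_set hRc hR0 hij hia
    have hSbdd : BddBelow S := ⟨0, fun t ht => ht.1.1.le⟩
    have hs_def : sAcc (D.pt 0) (D.pt 1) φ.boundaryExtension e R = sInf S := rfl
    have hsS : sAcc (D.pt 0) (D.pt 1) φ.boundaryExtension e R ∈ S :=
      hs_def ▸ hSc.csInf_mem ⟨1, h1S⟩ hSbdd
    have hs01 : sAcc (D.pt 0) (D.pt 1) φ.boundaryExtension e R ∈ Icc (0:ℝ) 1 :=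
      ⟨hsS.1.1.le, hsS.1.2⟩
    refine ⟨hs01, hsS.2, ray_zero hφ, continuousOn_ray hw, ?_, ?_, ?_, ?_⟩
    · exact (injOn_ray hw).mono (Icc_subset_Ici_self)
    · intro t ht htM
      have htS : t ∈ S := by
        rw [hS_eq]
        exact ⟨⟨ht.1, ht.2.le.trans hs01.2⟩, htM⟩
      exact (csInf_le hSbdd htS).not_gt (hs_def ▸ ht.2)
    · intro t ht
      exact ⟨ray_eq_or_mem hφ hw ht, ray_im_nonneg hw.le ht⟩
    · intro t ht
      rw [norm_ray t ht.1, hp, pAcc_eq, sqz_norm (squeeze_spec e), hi0]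
      exact mul_le_of_le_one_left (norm_nonneg _) ht.2

end Access

/-! ### The first cut time `uMid` -/

section UMid

variable (hφ : D.IsChordalUniformizing φ) (he0 : 0 < e) (he1 : e ≤ 1 / 2)
  (hRc : Continuous R) (hRmem : ∀ u, R u ∈ closure D.carrier) (hR0 : R 0 ∈ D.carrier)
  (hij : lastA (D.pt 0) R ≤ firstB (D.pt 1) R)

include hφ he0 he1 hRc hRmem hR0 hij in
/-- **The cut time `uMid` is attained**: `uMid ∈ [i, j]`, `Z uMid = Φ (sAcc · p)`, and no earlier time
of `[i, uMid)` is sent there by `Z`. -/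
theorem uMid_facts :
    uMid (D.pt 0) (D.pt 1) φ.boundaryExtension e R ∈ Icc (lastA (D.pt 0) R) (firstB (D.pt 1) R) ∧
    attZ (D.pt 1) φ.boundaryExtension e R (uMid (D.pt 0) (D.pt 1) φ.boundaryExtension e R) =
      φ.boundaryExtension ((sAcc (D.pt 0) (D.pt 1) φ.boundaryExtension e R : ℂ) *
        pAcc (D.pt 0) φ.boundaryExtension e R) ∧
    ∀ u' ∈ Ico (lastA (D.pt 0) R) (uMid (D.pt 0) (D.pt 1) φ.boundaryExtension e R),
      attZ (D.pt 1) φ.boundaryExtension e R u' ≠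
        φ.boundaryExtension ((sAcc (D.pt 0) (D.pt 1) φ.boundaryExtension e R : ℂ) *
          pAcc (D.pt 0) φ.boundaryExtension e R) := by
  set x := φ.boundaryExtension ((sAcc (D.pt 0) (D.pt 1) φ.boundaryExtension e R : ℂ) *
    pAcc (D.pt 0) φ.boundaryExtension e R) with hx
  set U : Set ℝ := {u : ℝ | u ∈ Icc (lastA (D.pt 0) R) (firstB (D.pt 1) R) ∧
    attZ (D.pt 1) φ.boundaryExtension e R u = x} with hU
  have hxM := (sAcc_facts hφ he0 he1 hRc hRmem hR0 hij).2.1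
  obtain ⟨u₀, hu₀, hu₀x⟩ := hxM
  have hUne : U.Nonempty := ⟨u₀, hu₀, hu₀x⟩
  have hZc : Continuous (attZ (D.pt 1) φ.boundaryExtension e R) :=
    (continuousOn_transport' hφ he0 he1).comp_continuous hRc hRmem
  have hUc : IsClosed U := isClosed_Icc.inter (isClosed_singleton.preimage hZc)
  have hUbdd : BddBelow U := ⟨lastA (D.pt 0) R, fun t ht => ht.1.1⟩
  have hu_def : uMid (D.pt 0) (D.pt 1) φ.boundaryExtension e R = sInf U := rfl
  have huU : uMid (D.pt 0) (D.pt 1) φ.boundaryExtension e R ∈ U := hu_def ▸ hUc.csInf_mem hUne hUbdd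
  refine ⟨huU.1, huU.2, fun u' hu' h => ?_⟩
  have hu'U : u' ∈ U := ⟨⟨hu'.1, hu'.2.le.trans huU.1.2⟩, h⟩
  exact (csInf_le hUbdd hu'U).not_gt (hu_def ▸ hu'.2)

include hφ he0 he1 hRc hRmem hR0 hij in
/-- At the cut time the polyline is `r₀/2`-close to `a` (squeeze `κ ≤ r₀/4`-close, access segment in
`B(a, r₀/4)`). -/
theorem dist_apply_uMid_lt {r₀ κ : ℝ} (hκ : 0 < κ) (hκr : κ ≤ r₀ / 4)
    (hclose : ∀ z : ℂ, 0 ≤ z.im → dist (φ.boundaryExtension (squeeze e z)) (φ.boundaryExtension z) < κ)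
    (hacc : ∀ z : ℂ, 0 ≤ z.im → ‖z‖ ≤ ‖hinv φ.boundaryExtension (R 0)‖ →
      dist (φ.boundaryExtension z) (D.pt 0) < r₀ / 4) :
    dist (R (uMid (D.pt 0) (D.pt 1) φ.boundaryExtension e R)) (D.pt 0) < r₀ / 2 := by
  obtain ⟨hs01, -, -, -, -, -, hmem, hnorm⟩ := sAcc_facts hφ he0 he1 hRc hRmem hR0 hij
  obtain ⟨-, hZu, -⟩ := uMid_facts hφ he0 he1 hRc hRmem hR0 hij
  have h1 : dist (attZ (D.pt 1) φ.boundaryExtension e R (uMid (D.pt 0) (D.pt 1) φ.boundaryExtension e R))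
      (R (uMid (D.pt 0) (D.pt 1) φ.boundaryExtension e R)) < κ :=
    dist_transport'_lt hφ hκ hclose (hRmem _)
  have h2 := hacc _ (hmem _ hs01.1).2 (hnorm _ hs01)
  rw [← hZu] at h2
  rw [dist_comm] at h1
  linarith [dist_triangle (R (uMid (D.pt 0) (D.pt 1) φ.boundaryExtension e R))
    (attZ (D.pt 1) φ.boundaryExtension e R (uMid (D.pt 0) (D.pt 1) φ.boundaryExtension e R)) (D.pt 0)]

include hφ he0 he1 hRc hRmem hR0 hij in
/-- **No deep return before the cut**: the polyline is `ε₀`-close to `a` on `[0, uMid]`. -/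
theorem dist_lt_of_le_uMid {ε₀ r₀ κ : ℝ} (hrε : r₀ < ε₀) (hκ : 0 < κ) (hκr : κ ≤ r₀ / 4)
    (hclose : ∀ z : ℂ, 0 ≤ z.im → dist (φ.boundaryExtension (squeeze e z)) (φ.boundaryExtension z) < κ)
    (hacc : ∀ z : ℂ, 0 ≤ z.im → ‖z‖ ≤ ‖hinv φ.boundaryExtension (R 0)‖ →
      dist (φ.boundaryExtension z) (D.pt 0) < r₀ / 4)
    (hNR : ∀ s t : ℝ, 0 ≤ s → s < t → t ≤ 1 → ε₀ ≤ dist (R s) (D.pt 0) →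
      dist (R t) (D.pt 0) ≤ r₀ → False)
    {t : ℝ} (ht0 : 0 ≤ t) (ht : t ≤ uMid (D.pt 0) (D.pt 1) φ.boundaryExtension e R) :
    dist (R t) (D.pt 0) < ε₀ := by
  have hu := dist_apply_uMid_lt hφ he0 he1 hRc hRmem hR0 hij hκ hκr hclose hacc
  have hu1 : uMid (D.pt 0) (D.pt 1) φ.boundaryExtension e R ≤ 1 :=
    (uMid_facts hφ he0 he1 hRc hRmem hR0 hij).1.2.trans (firstB_mem_Icc' hRc (D.pt 1)).2
  have hr₀ : 0 < r₀ := by linarith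
  rcases ht.lt_or_eq with hlt | heq
  · by_contra hge
    rw [not_lt] at hge
    exact hNR t _ ht0 hlt hu1 hge (by linarith)
  · rw [heq]
    linarith

end UMid

end FaithfulAttach

end Summit.CriticalPhenomena.SAWScalingLimit.Theorems
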